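import Summits.ResolutionOfSingularities.ResolutionOfSingularities.Theorems.HilbertSamuelEliminationSigmaMaxModificationsCorridor3WLadderBirthForms
import Mathlib.RingTheory.Nullstellensatz
import Mathlib.LinearAlgebra.Dual.Lemmas
import Mathlib.Algebra.MvPolynomial.Division
import Mathlib.Algebra.MvPolynomial.Nilpotent
import Mathlib.LinearAlgebra.Matrix.Determinant.Basic
import HarnessLib

/-!
# [OURS · L1 W4.2] (b-end)₃ W-TOP BIRTHS — BIRTHS BELOW THE BAND ARE LINES (Nullstellensatz form of `birthTidy`)
# (cell res-hironaka, LADDER-RESOLUTION rung L; slot W4.2, crux chain w42 `SigmaMaxModificationsCorridor3`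
# stmt-ResolutionOfSingularities-19249; `--supports stmt-ResolutionOfSingularities-19249 --as helper`; res-L1-w42-plan-1 W4.2 DEAL
# object D9, hand res-D-pv-002; companion of `…Corridor3WLadderStrataBirthsTop.lean` p512089)

Everything here is OURS (elementary algebra over an algebraically closed field: Mathlib's Nullstellensatz, linear duals, primality
of `U₀` in the polynomial ring; by name over `…BirthDefs` p505417 / `…BirthForms` p506417); NOT a statement of Hironaka's manuscript
[Hironaka2017] nor of [CossartJannsenSaito2020]; no `Literature.…` named fact; never a `Theses/…` import. AI-written; no expert
review; AI review is weaker than expert review.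

## Why (the shape of res-type-067's BIRTH DICTIONARY, PATH (a) of plan-1 g9 2026-08-27T07:52:17Z)

The dictionary's fibre-birth datum is a CURVE `V(G) ⊂ ℙ(Dir_{x_n}/T_{x_n}D)` all of whose directions (over every field, in
particular over an algebraic closure) are NEAR, i.e. satisfy `VanishesToOrder (in_{d_i} c_i) w (2(m−i) − d_i)` for every
coefficient index. Below the band (`2 d_{i₀} < 3(2(m − i₀) − d_{i₀})` for some `i₀`, `δ(Δ) < 6/5`) `birthTidy` forbids three
linearly independent near directions; this file turns that into the structural statement the no-recurrent-birth row must then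
exclude: SUCH A CURVE IS ONE LINE.

## What is proved

* `Birth.exists_eq_C_mul_linear_pow_of_zeros_dependent` — over an algebraically closed field `K`: if the zero set of
  `G ∈ K[U₀,U₁,U₂]` contains no three linearly independent vectors, then `G = u · L^n` with `L` the first coordinate form of an
  invertible frame `M` (`L = M.toMvPolynomial 0`, `IsUnit M.det`) — set-theoretically `V(G)` is a single line of `ℙ²` (or empty:
  `n = 0`). Proof: the zeros span a proper subspace (else `exists_linearIndependent` extracts a basis of `K³` out of them), so a
  non-zero linear functional `φ` kills them (`Submodule.exists_dual_map_eq_bot_of_lt_top`); complete its coefficient row to an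
  invertible `M` (`Matrix.det_fin_three`); the Nullstellensatz (`MvPolynomial.vanishingIdeal_zeroLocus_eq_radical`) gives
  `G ∣ L^n`; in the frame `M` (`aeval_toMvPolynomial_aeval_toMvPolynomial_of_mul_eq_one`, p506417) `L` becomes the prime `U₀`
  (`MvPolynomial.X_prime`), so `G` is a unit times `U₀^i` (`dvd_prime_pow`, `isUnit_iff_eq_C_of_isReduced`); transport back.
* `Birth.exists_eq_C_mul_linear_pow_of_forall_zero_vanishesToOrder` — **BIRTHS BELOW THE BAND ARE LINES**: `F ≠ 0` a form of
  degree `d`, `2d < 3μ`, `K` algebraically closed, and `F` vanishing to order `μ` at every zero of `G` ⇒ `G = u · L^n`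
  (`birthTidy` p506417 + the previous theorem).
-/

noncomputable section

set_option linter.dupNamespace false

namespace Summit.ResolutionOfSingularities.ResolutionOfSingularities.Theorems.SigmaMaxModificationsCorridor3.Birth

open MvPolynomial

/-- **Three zeros in general position, or a line.** Over an algebraically closed field, if the zero set of a ternary
polynomial `G` contains NO three linearly independent vectors, then `G` is a constant times a power of ONE linear form
(`G = u · L^n`, `L` the first coordinate of an invertible frame `M`): set-theoretically `V(G) ⊆ ℙ²` is a single line (or
empty). Proof: the zeros span a proper subspace, so a non-zero linear form `L` vanishes on them; by the Nullstellensatz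
`G ∣ L^n`; in a frame with `L = U₀` the prime `U₀` forces `G = u·U₀^i`. [folklore] -/
theorem exists_eq_C_mul_linear_pow_of_zeros_dependent {K : Type} [Field K] [IsAlgClosed K]
    (G : MvPolynomial (Fin 3) K)
    (h : ∀ b : Fin 3 → (Fin 3 → K), (∀ t, eval (b t) G = 0) → ¬ LinearIndependent K b) :
    ∃ (M : Matrix (Fin 3) (Fin 3) K) (u : K) (n : ℕ), IsUnit M.det ∧ G = C u * (M.toMvPolynomial 0) ^ n := by
  classical
  -- (1) the zeros span a proper subspace
  set S : Set (Fin 3 → K) := {w | eval w G = 0} with hS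
  have hlt : Submodule.span K S < ⊤ := by
    rw [lt_top_iff_ne_top]
    intro htop
    obtain ⟨b, hbS, hspan, hli⟩ := exists_linearIndependent K S
    rw [htop] at hspan
    have hfin : b.Finite := hli.setFinite
    haveI : Fintype b := hfin.fintype
    let B : Module.Basis b K (Fin 3 → K) :=
      Module.Basis.mk hli (by rw [Subtype.range_coe_subtype, Set.setOf_mem_eq, hspan])
    have hcard : Fintype.card b = 3 := by
      have := Module.finrank_eq_card_basis B
      rw [Module.finrank_fin_fun] at this
      exact this.symm
    let e : b ≃ Fin 3 := Fintype.equivFinOfCardEq hcard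
    have hli' : LinearIndependent K (fun t : Fin 3 => ((e.symm t : b) : Fin 3 → K)) :=
      hli.comp e.symm e.symm.injective
    exact h _ (fun t => hbS (e.symm t).2) hli'
  -- (2) a non-zero linear form vanishing on the zeros
  obtain ⟨φ, hφ0, hφ⟩ := Submodule.exists_dual_map_eq_bot_of_lt_top hlt inferInstance
  have hφS : ∀ w ∈ S, φ w = 0 := fun w hw => by
    have : φ w ∈ (Submodule.span K S).map φ := Submodule.mem_map_of_mem (Submodule.subset_span hw)
    rwa [hφ, Submodule.mem_bot] at this
  set lam : Fin 3 → K := fun i => φ (fun j => if i = j then 1 else 0) with hlam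
  have hφsum : ∀ w : Fin 3 → K, φ w = ∑ i, lam i * w i := fun w => by
    rw [LinearMap.pi_apply_eq_sum_univ φ w]
    refine Finset.sum_congr rfl fun i _ => ?_
    rw [smul_eq_mul, mul_comm]
  have hlam0 : lam ≠ 0 := by
    intro h0
    apply hφ0
    apply LinearMap.ext
    intro w
    rw [hφsum, LinearMap.zero_apply]
    simp [h0]
  -- (3) an invertible frame with first row `lam`
  obtain ⟨i₀, hi₀⟩ : ∃ i, lam i ≠ 0 := by
    by_contra hne
    push Not at hne
    exact hlam0 (funext hne)
  obtain ⟨M, hMdet, hM0⟩ : ∃ M : Matrix (Fin 3) (Fin 3) K, IsUnit M.det ∧ M 0 = lam := by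
    fin_cases i₀
    · refine ⟨Matrix.of ![lam, Pi.single 1 1, Pi.single 2 1], ?_, rfl⟩
      rw [isUnit_iff_ne_zero, Matrix.det_fin_three]
      simpa [Matrix.of_apply] using hi₀
    · refine ⟨Matrix.of ![lam, Pi.single 0 1, Pi.single 2 1], ?_, rfl⟩
      rw [isUnit_iff_ne_zero, Matrix.det_fin_three]
      simpa [Matrix.of_apply] using hi₀
    · refine ⟨Matrix.of ![lam, Pi.single 0 1, Pi.single 1 1], ?_, rfl⟩
      rw [isUnit_iff_ne_zero, Matrix.det_fin_three]
      simpa [Matrix.of_apply] using hi₀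
  -- (4) the linear form `L = M.toMvPolynomial 0` vanishes on the zeros of `G`
  have hL : ∀ w ∈ S, eval w (M.toMvPolynomial 0) = 0 := fun w hw => by
    rw [Matrix.toMvPolynomial_eval_eq_apply, Matrix.mulVec, dotProduct, hM0, ← hφsum]
    exact hφS w hw
  -- (5) Nullstellensatz: `G ∣ L^n`
  have hrad : M.toMvPolynomial 0 ∈ (Ideal.span {G}).radical := by
    rw [← vanishingIdeal_zeroLocus_eq_radical (K := K), mem_vanishingIdeal_iff]
    intro x hx
    have hxG : eval x G = 0 := by
      simpa using (mem_zeroLocus_iff.mp hx) G (Ideal.subset_span rfl)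
    simpa using hL x hxG
  obtain ⟨n, hn⟩ := Ideal.mem_radical_iff.mp hrad
  have hdvd : G ∣ M.toMvPolynomial 0 ^ n := Ideal.mem_span_singleton.mp hn
  -- (6) in the frame `M` the form is `U₀`: transport, use that `U₀` is prime, transport back
  have hMinv : M * M⁻¹ = 1 := M.mul_nonsing_inv hMdet
  have hMinv' : M⁻¹ * M = 1 := M.nonsing_inv_mul hMdet
  have hψL : aeval (M⁻¹).toMvPolynomial (M.toMvPolynomial 0) = (X 0 : MvPolynomial (Fin 3) K) := by
    conv_lhs => rw [show M.toMvPolynomial 0 = aeval M.toMvPolynomial (X 0 : MvPolynomial (Fin 3) K) from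
      (aeval_X _ 0).symm]
    exact aeval_toMvPolynomial_aeval_toMvPolynomial_of_mul_eq_one M M⁻¹ hMinv _
  have hdvd' : aeval (M⁻¹).toMvPolynomial G ∣ (X 0 : MvPolynomial (Fin 3) K) ^ n := by
    have := map_dvd (aeval (M⁻¹).toMvPolynomial) hdvd
    rwa [map_pow, hψL] at this
  obtain ⟨i, -, hassoc⟩ := (dvd_prime_pow (X_prime : Prime (X (0 : Fin 3) : MvPolynomial (Fin 3) K)) n).mp hdvd'
  obtain ⟨v, hv⟩ := hassoc.symm
  -- `v` is a unit of the polynomial ring, hence a non-zero constant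
  obtain ⟨r, -, hr⟩ := (isUnit_iff_eq_C_of_isReduced (P := (↑v : MvPolynomial (Fin 3) K))).mp v.isUnit
  have hψG : aeval (M⁻¹).toMvPolynomial G = C r * X 0 ^ i := by rw [← hv, hr, mul_comm]
  refine ⟨M, r, i, hMdet, ?_⟩
  have hback := aeval_toMvPolynomial_aeval_toMvPolynomial_of_mul_eq_one M⁻¹ M hMinv' G
  rw [hψG, map_mul, map_pow, algHom_C, algebraMap_eq, aeval_X] at hback
  exact hback.symm

/-- **BIRTHS BELOW THE BAND ARE LINES.** Over an algebraically closed field: if a non-zero ternary form `F` of degree `d`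
with `2d < 3μ` vanishes to order `μ` at EVERY zero of a polynomial `G` (e.g. the in-fibre equation of a newborn curve all of
whose directions are near), then `G = u · L^n` for one linear form `L` — the newborn curve is a LINE of `ℙ(Dir)` (`birthTidy` +
`exists_eq_C_mul_linear_pow_of_zeros_dependent`). NOT a statement of the manuscript. [folklore] -/
theorem exists_eq_C_mul_linear_pow_of_forall_zero_vanishesToOrder {K : Type} [Field K] [IsAlgClosed K]
    {F : MvPolynomial (Fin 3) K} {d μ : ℕ} (hF : F.IsHomogeneous d) (hF0 : F ≠ 0) (hband : 2 * d < 3 * μ)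
    (G : MvPolynomial (Fin 3) K) (hnear : ∀ w : Fin 3 → K, eval w G = 0 → VanishesToOrder F w μ) :
    ∃ (M : Matrix (Fin 3) (Fin 3) K) (u : K) (n : ℕ), IsUnit M.det ∧ G = C u * (M.toMvPolynomial 0) ^ n :=
  exists_eq_C_mul_linear_pow_of_zeros_dependent G fun b hb hli =>
    birthTidy K F d μ hF hF0 hband b hli fun t => hnear _ (hb t)

end Summit.ResolutionOfSingularities.ResolutionOfSingularities.Theorems.SigmaMaxModificationsCorridor3.Birth

end
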